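import Summits.AnomalousDissipation.AnomalousDissipation.Theorems.BaireTransferRobustLoudUpgradeLine
import Summits.AnomalousDissipation.AnomalousDissipation.Theorems.BaireTransferRobustLoudUpgradeStubSteadyWindow
import Literature.Analysis.FluidPDE.LongTimeAveragePeriodic
import Literature.Analysis.FluidPDE.TorusClassicalLerayHopfProofs
import Literature.Analysis.FunctionSpaces.TorusFourierCalculus
import Literature.Analysis.FunctionSpaces.TorusCalculusProofs
import Literature.Analysis.FunctionSpaces.TorusSpaceTime

/-!
# Stub `stub_periodicWindow` of the line `malkin-cone-group-orbits`
# (crux stmt-AnomalousDissipation-1144, `BaireTransfer.RobustLoudUpgrade`, lead's reshape v3)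

`persistPeriodic S a E ε ⊆ interior (loud S a E ε)` — the periodic twin of `stub_steadyWindow`:
if `c` carries at `ν ∈ (0,a)` a `τ`-periodic classical solution `u` of `NS_ν(f_c)` on `ℝ × T³` with
STRICT budgets `⟨‖u‖²⟩ < E`, `ε < ⟨ν‖∇u‖²⟩` which PERSISTS in the sense of `PeriodicPersistsAt`
(for every `δ > 0` all nearby forces `f_{c'}` carry, at the same `ν`, a `τ'`-periodic classical
solution `u'` with `∫‖u'(t) − u(τt/τ')‖² + ‖∇(u'(t) − u(τt/τ'))‖₂² ≤ δ` for all `t`), then a whole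
ball around `c` is loud.  The period means are period integrals (`meanEnergy_eq_of_periodic`,
`meanDissipation_eq_of_periodic`); pointwise in time the Peter–Paul inequalities of the steady window
(`SteadyWindow.integral_norm_sq_le`, `SteadyWindow.gradNormSq_le`) bound `∫‖u'(t)‖²` from above and
`‖∇u'(t)‖₂²` from below by the time-rescaled budgets of `u` plus `(1 + η⁻¹)δ`; integrating over
`[0, τ']` and substituting `s = τt/τ'` turns the rescaled period integral of `u` into its own period
mean (`integral_comp_rescale`), so `⟨‖u'‖²⟩ ≤ (1+η)⟨‖u‖²⟩ + (1+η⁻¹)δ` and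
`⟨ν‖∇u'‖²⟩ ≥ (1+η)⁻¹(⟨ν‖∇u‖²⟩ − ν(1+η⁻¹)δ)`; `η`, then `δ`, are chosen inside the strict slack.

References: D. Henry, *Geometric Theory of Semilinear Parabolic Equations*, LNM 840 (1981), Ch. 8
(the persistence hypothesis is the conclusion of its perturbation theorem for nondegenerate periodic
orbits; only the elementary window step is done here); the vocabulary module
`Theorems/BaireTransferRobustLoudUpgradeLine.lean` (§6, reshape v3); patterns from
`Theorems/BaireTransferRobustLoudUpgradeStubSteadyWindow.lean` and
`Cruxes/RobustLoudUpgrade/Disproof.lean` §9 (`meanDissipation_eq_period_mean`, `timeRescale`).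
-/

-- `Summit.<Summit>.<Problem>` is the tree's mandated summit-side namespace (CONVENTIONS §2); for this
-- single-conjunct summit the two coincide, so the duplicate is deliberate.
set_option linter.dupNamespace false

noncomputable section

open scoped BigOperators Topology
open Filter Set Function TopologicalSpace MeasureTheory

namespace Summit.AnomalousDissipation.AnomalousDissipation.Theorems.RobustLoudUpgrade.PeriodicWindow

open Literature.Analysis.FunctionSpaces Literature.Analysis.FunctionSpaces.Torus
open Literature.Analysis.FluidPDE

/-! ## Period means of time-periodic smooth fields on `ℝ × T³` -/

section Means

variable {τ τ' : ℝ} {u u' : ℝ → UnitAddTorus (Fin 3) → EuclideanSpace ℝ (Fin 3)}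

-- pattern from Cruxes/RobustLoudUpgrade/Disproof.lean §9 (`meanDissipation_eq_period_mean`)
/-- The mean dissipation of a periodic smooth field is the period mean of `ν‖∇u‖₂²` with POINTWISE
gradients. [folklore] -/
theorem meanDissipation_eq_period_mean (hu : IsSmoothSpaceTimeOn univ u)
    (hper : Function.Periodic u τ) (hτ : 0 < τ) (ν : ℝ) :
    meanDissipation ν u = τ⁻¹ * (ν * ∫ t in (0 : ℝ)..τ, gradNormSq (u t)) := by
  rw [meanDissipation_eq_of_periodic hper hτ]
  congr 1
  rw [← intervalIntegral.integral_const_mul]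
  refine intervalIntegral.integral_congr fun t _ => ?_
  rw [gradNormSq_eq_toReal_eGradNormSq_holds (hu.isSmooth_slice (mem_univ t))]

/-- `t ↦ ∫‖u t‖²` is continuous for a jointly smooth field. [folklore] -/
theorem continuous_energy (hu : IsSmoothSpaceTimeOn univ u) :
    Continuous fun t => ∫ x, ‖u t x‖ ^ 2 := by
  rw [← continuousOn_univ]
  exact hu.normSq.continuousOn_integral convex_univ

/-- `t ↦ ‖∇u t‖₂²` is continuous for a jointly smooth field. [folklore] -/
theorem continuous_gradNormSq (hu : IsSmoothSpaceTimeOn univ u) :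
    Continuous fun t => gradNormSq (u t) := by
  rw [← continuousOn_univ]
  exact hu.continuousOn_gradNormSq convex_univ uniqueDiffOn_univ

/-- Substitution in a period integral: `∫₀^{τ'} g(τ/τ'·t) dt = (τ/τ')⁻¹ ∫₀^τ g`. [folklore] -/
theorem integral_comp_rescale (g : ℝ → ℝ) (hτ : 0 < τ) (hτ' : 0 < τ') :
    ∫ t in (0 : ℝ)..τ', g (τ / τ' * t) = (τ / τ')⁻¹ * ∫ s in (0 : ℝ)..τ, g s := by
  rw [intervalIntegral.integral_comp_mul_left g (div_ne_zero hτ.ne' hτ'.ne'), mul_zero,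
    div_mul_cancel₀ τ hτ'.ne', smul_eq_mul]

/-- **Mean energy is upper semi-stable**: if `u'` (`τ'`-periodic) stays `L²`-within `δ` of the
time-rescaled `u` (`τ`-periodic), then `⟨‖u'‖²⟩ ≤ (1 + η)⟨‖u‖²⟩ + (1 + η⁻¹)δ` for every `η > 0`.
[folklore] -/
theorem meanEnergy_le_of_close (hu : IsSmoothSpaceTimeOn univ u) (hper : Function.Periodic u τ)
    (hτ : 0 < τ) (hu' : IsSmoothSpaceTimeOn univ u') (hper' : Function.Periodic u' τ')
    (hτ' : 0 < τ') {δ η : ℝ} (hη : 0 < η)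
    (hclose : ∀ t, ∫ x, ‖u' t x - u (τ / τ' * t) x‖ ^ 2 ≤ δ) :
    meanEnergy u' ≤ (1 + η) * meanEnergy u + (1 + η⁻¹) * δ := by
  have hec' : Continuous fun t => ∫ x, ‖u' t x‖ ^ 2 := continuous_energy hu'
  have hecκ : Continuous fun t => ∫ x, ‖u (τ / τ' * t) x‖ ^ 2 :=
    (continuous_energy hu).comp (continuous_const.mul continuous_id)
  -- pointwise in time: Peter–Paul
  have hpt : ∀ t, ∫ x, ‖u' t x‖ ^ 2 ≤ (1 + η) * (∫ x, ‖u (τ / τ' * t) x‖ ^ 2) + (1 + η⁻¹) * δ := by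
    intro t
    have h1 := SteadyWindow.integral_norm_sq_le (hu.isSmooth_slice (mem_univ (τ / τ' * t))).continuous
      (hu'.isSmooth_slice (mem_univ t)).continuous hη
    have hK : 0 ≤ 1 + η⁻¹ := by positivity
    exact h1.trans (by gcongr; exact hclose t)
  -- integrate over one period of `u'`
  have hI : ∫ t in (0 : ℝ)..τ', (∫ x, ‖u' t x‖ ^ 2) ≤
      ∫ t in (0 : ℝ)..τ', ((1 + η) * (∫ x, ‖u (τ / τ' * t) x‖ ^ 2) + (1 + η⁻¹) * δ) :=
    intervalIntegral.integral_mono_on hτ'.le (hec'.intervalIntegrable _ _)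
      (((continuous_const.mul hecκ).add continuous_const).intervalIntegrable _ _) fun t _ => hpt t
  have hR : ∫ t in (0 : ℝ)..τ', ((1 + η) * (∫ x, ‖u (τ / τ' * t) x‖ ^ 2) + (1 + η⁻¹) * δ) =
      (1 + η) * ((τ / τ')⁻¹ * ∫ s in (0 : ℝ)..τ, ∫ x, ‖u s x‖ ^ 2) + τ' * ((1 + η⁻¹) * δ) := by
    have i1 : IntervalIntegrable (fun t => (1 + η) * ∫ x, ‖u (τ / τ' * t) x‖ ^ 2) volume 0 τ' :=
      (continuous_const.mul hecκ).intervalIntegrable _ _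
    have i2 : IntervalIntegrable (fun _ => (1 + η⁻¹) * δ) volume 0 τ' := intervalIntegrable_const
    rw [intervalIntegral.integral_add i1 i2, intervalIntegral.integral_const_mul,
      integral_comp_rescale (fun s => ∫ x, ‖u s x‖ ^ 2) hτ hτ', intervalIntegral.integral_const,
      sub_zero, smul_eq_mul]
  rw [meanEnergy_eq_of_periodic hper' hτ', meanEnergy_eq_of_periodic hper hτ]
  calc τ'⁻¹ * ∫ t in (0 : ℝ)..τ', ∫ x, ‖u' t x‖ ^ 2
      ≤ τ'⁻¹ * ((1 + η) * ((τ / τ')⁻¹ * ∫ s in (0 : ℝ)..τ, ∫ x, ‖u s x‖ ^ 2) +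
          τ' * ((1 + η⁻¹) * δ)) := by
        rw [← hR]
        exact mul_le_mul_of_nonneg_left hI (inv_nonneg.2 hτ'.le)
    _ = (1 + η) * (τ⁻¹ * ∫ s in (0 : ℝ)..τ, ∫ x, ‖u s x‖ ^ 2) + (1 + η⁻¹) * δ := by
        field_simp

/-- **Mean dissipation is lower semi-stable**: if `u'` (`τ'`-periodic) stays `Ḣ¹`-within `δ` of the
time-rescaled `u` (`τ`-periodic), then `(1 + η)⁻¹ (⟨ν‖∇u‖²⟩ − ν(1 + η⁻¹)δ) ≤ ⟨ν‖∇u'‖²⟩` for every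
`η > 0`, `ν ≥ 0`. [folklore] -/
theorem meanDissipation_ge_of_close (hu : IsSmoothSpaceTimeOn univ u) (hper : Function.Periodic u τ)
    (hτ : 0 < τ) (hu' : IsSmoothSpaceTimeOn univ u') (hper' : Function.Periodic u' τ')
    (hτ' : 0 < τ') {ν δ η : ℝ} (hν : 0 ≤ ν) (hη : 0 < η)
    (hclose : ∀ t, gradNormSq (fun x => u' t x - u (τ / τ' * t) x) ≤ δ) :
    (1 + η)⁻¹ * (meanDissipation ν u - ν * ((1 + η⁻¹) * δ)) ≤ meanDissipation ν u' := by
  have hgc' : Continuous fun t => gradNormSq (u' t) := continuous_gradNormSq hu'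
  have hgcκ : Continuous fun t => gradNormSq (u (τ / τ' * t)) :=
    (continuous_gradNormSq hu).comp (continuous_const.mul continuous_id)
  have hη1 : 0 < 1 + η := by linarith
  -- pointwise in time: Peter–Paul
  have hpt : ∀ t, (1 + η)⁻¹ * (gradNormSq (u (τ / τ' * t)) - (1 + η⁻¹) * δ) ≤ gradNormSq (u' t) := by
    intro t
    have h1 := SteadyWindow.gradNormSq_le (hu.isSmooth_slice (mem_univ (τ / τ' * t)))
      (hu'.isSmooth_slice (mem_univ t)) hη
    have hK : 0 ≤ 1 + η⁻¹ := by positivity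
    have h3 : gradNormSq (u (τ / τ' * t)) ≤ (1 + η) * gradNormSq (u' t) + (1 + η⁻¹) * δ :=
      h1.trans (by gcongr; exact hclose t)
    rw [inv_mul_le_iff₀ hη1]
    linarith
  -- integrate over one period of `u'`
  have hI : ∫ t in (0 : ℝ)..τ', (1 + η)⁻¹ * (gradNormSq (u (τ / τ' * t)) - (1 + η⁻¹) * δ) ≤
      ∫ t in (0 : ℝ)..τ', gradNormSq (u' t) :=
    intervalIntegral.integral_mono_on hτ'.le
      ((continuous_const.mul (hgcκ.sub continuous_const)).intervalIntegrable _ _)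
      (hgc'.intervalIntegrable _ _) fun t _ => hpt t
  have hL : ∫ t in (0 : ℝ)..τ', (1 + η)⁻¹ * (gradNormSq (u (τ / τ' * t)) - (1 + η⁻¹) * δ) =
      (1 + η)⁻¹ * ((τ / τ')⁻¹ * (∫ s in (0 : ℝ)..τ, gradNormSq (u s)) - τ' * ((1 + η⁻¹) * δ)) := by
    have i1 : IntervalIntegrable (fun t => gradNormSq (u (τ / τ' * t))) volume 0 τ' :=
      hgcκ.intervalIntegrable _ _
    have i2 : IntervalIntegrable (fun _ => (1 + η⁻¹) * δ) volume 0 τ' := intervalIntegrable_const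
    rw [intervalIntegral.integral_const_mul, intervalIntegral.integral_sub i1 i2,
      integral_comp_rescale (fun s => gradNormSq (u s)) hτ hτ',
      intervalIntegral.integral_const, sub_zero, smul_eq_mul]
  rw [meanDissipation_eq_period_mean hu' hper' hτ' ν, meanDissipation_eq_period_mean hu hper hτ ν]
  calc (1 + η)⁻¹ * (τ⁻¹ * (ν * ∫ s in (0 : ℝ)..τ, gradNormSq (u s)) - ν * ((1 + η⁻¹) * δ))
      = τ'⁻¹ * (ν * ((1 + η)⁻¹ *
          ((τ / τ')⁻¹ * (∫ s in (0 : ℝ)..τ, gradNormSq (u s)) - τ' * ((1 + η⁻¹) * δ)))) := by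
        field_simp
    _ ≤ τ'⁻¹ * (ν * ∫ t in (0 : ℝ)..τ', gradNormSq (u' t)) := by
        rw [← hL]
        exact mul_le_mul_of_nonneg_left (mul_le_mul_of_nonneg_left hI hν) (inv_nonneg.2 hτ'.le)

/-- Choice of the Young parameter inside strict budget slack: `0 ≤ A < B`, `e < D` give `η > 0`
with `(1 + η)A < B` and `(1 + η)e < D`. [folklore] -/
theorem exists_eta {A B e D : ℝ} (hAB : A < B) (heD : e < D) :
    ∃ η : ℝ, 0 < η ∧ (1 + η) * A < B ∧ (1 + η) * e < D := by
  have h1 : ∀ᶠ η : ℝ in 𝓝 0, (1 + η) * A < B :=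
    Filter.Tendsto.eventually_lt_const (v := (1 + 0) * A) (by simpa using hAB)
      (((continuous_const.add continuous_id).mul continuous_const).tendsto' _ _ rfl)
  have h2 : ∀ᶠ η : ℝ in 𝓝 0, (1 + η) * e < D :=
    Filter.Tendsto.eventually_lt_const (v := (1 + 0) * e) (by simpa using heD)
      (((continuous_const.add continuous_id).mul continuous_const).tendsto' _ _ rfl)
  obtain ⟨η, ⟨hE, hD⟩, hη⟩ := (((h1.and h2).filter_mono nhdsWithin_le_nhds).and
    (self_mem_nhdsWithin : Set.Ioi (0 : ℝ) ∈ 𝓝[>] (0 : ℝ))).exists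
  exact ⟨η, hη, hE, hD⟩

/-- Choice of the closeness radius inside the remaining slack. [folklore] -/
theorem exists_delta {sE sD ν η : ℝ} (hsE : 0 < sE) (hsD : 0 < sD) (hν : 0 < ν) (hη : 0 < η) :
    ∃ δ : ℝ, 0 < δ ∧ (1 + η⁻¹) * δ ≤ sE ∧ ν * ((1 + η⁻¹) * δ) ≤ sD := by
  have hK : 0 < 1 + η⁻¹ := by positivity
  refine ⟨min (sE / (1 + η⁻¹)) (sD / (ν * (1 + η⁻¹))), lt_min (by positivity) (by positivity),
    ?_, ?_⟩
  · calc (1 + η⁻¹) * min (sE / (1 + η⁻¹)) (sD / (ν * (1 + η⁻¹)))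
        ≤ (1 + η⁻¹) * (sE / (1 + η⁻¹)) := by gcongr; exact min_le_left _ _
      _ = sE := by field_simp
  · calc ν * ((1 + η⁻¹) * min (sE / (1 + η⁻¹)) (sD / (ν * (1 + η⁻¹))))
        ≤ ν * ((1 + η⁻¹) * (sD / (ν * (1 + η⁻¹)))) := by gcongr; exact min_le_right _ _
      _ = sD := by field_simp

end Means

/-! ## The stub -/

/-- **Periodic window** (registered stub `stub_periodicWindow` of the line `malkin-cone-group-orbits`,
lead's reshape v3): a persistent loud periodic witness with strict budgets makes a neighbourhood of
its force loud, `persistPeriodic S a E ε ⊆ interior (loud S a E ε)`.  Proof: pick `η > 0` inside the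
strict slack (`(1+η)⟨‖u‖²⟩ < E`, `(1+η)ε < ⟨ν‖∇u‖²⟩`), then `δ > 0` absorbing a uniform-in-time
`L² ∩ Ḣ¹` perturbation of squared size `δ`; `PeriodicPersistsAt` gives a ball of forces whose
periodic classical solutions `u'` at the same `ν` stay within `δ` of the time-rescaled `u`, and
`meanEnergy_le_of_close` / `meanDissipation_ge_of_close` keep their budgets `≤ E`, `≥ ε`. [folklore] -/
theorem stub_periodicWindow : ∀ (S : Finset (Fin 3 → ℤ)) (a E ε : ℝ), persistPeriodic S a E ε ⊆ interior (loud S a E ε) := by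
  intro S a E ε c hc
  obtain ⟨ν, hν, hνa, τ, u, p, hτ, hsol, hper, hE, hε, hP⟩ := hc
  have hu := hsol.smooth_velocity
  obtain ⟨η, hη, hηE, hηD⟩ := exists_eta hE hε
  obtain ⟨δ, hδ, hδE, hδD⟩ := exists_delta (sE := E - (1 + η) * meanEnergy u)
    (sD := meanDissipation ν u - (1 + η) * ε) (by linarith) (by linarith) hν hη
  obtain ⟨r, hr, hball⟩ := hP δ hδ
  rw [mem_interior_iff_mem_nhds, Metric.mem_nhds_iff]
  refine ⟨r, hr, fun c' hc' => ?_⟩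
  obtain ⟨τ', u', p', hτ', hsol', hper', hcl⟩ := hball c' (Metric.mem_ball.1 hc')
  have hu' := hsol'.smooth_velocity
  refine ⟨ν, hν, hνa, τ', u', p', hτ', hsol', hper', ?_, ?_⟩
  · have hcl2 : ∀ t, ∫ x, ‖u' t x - u (τ / τ' * t) x‖ ^ 2 ≤ δ := fun t =>
      le_trans (le_add_of_nonneg_right (gradNormSq_nonneg _)) (hcl t)
    have h := meanEnergy_le_of_close hu hper hτ hu' hper' hτ' hη hcl2
    linarith
  · have hcl1 : ∀ t, gradNormSq (fun x => u' t x - u (τ / τ' * t) x) ≤ δ := fun t =>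
      le_trans (le_add_of_nonneg_left (integral_nonneg fun x => sq_nonneg _)) (hcl t)
    have h := meanDissipation_ge_of_close hu hper hτ hu' hper' hτ' hν.le hη hcl1
    have hη1 : 0 < 1 + η := by linarith
    have h2 : ε ≤ (1 + η)⁻¹ * (meanDissipation ν u - ν * ((1 + η⁻¹) * δ)) := by
      rw [le_inv_mul_iff₀ hη1]
      linarith
    exact h2.trans h

end Summit.AnomalousDissipation.AnomalousDissipation.Theorems.RobustLoudUpgrade.PeriodicWindow

end
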